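import Mathlib.Analysis.Matrix.Normed
import Mathlib.Analysis.Calculus.FDeriv.Mul
import Mathlib.Analysis.Calculus.FDeriv.Add
import Mathlib.Analysis.Normed.Module.FiniteDimension
import Mathlib.LinearAlgebra.Matrix.NonsingularInverse
import Mathlib.Topology.Instances.Matrix
import HarnessLib

/-!
# The Cayley sandwich `Y ↦ S(W, Y) = (1 − W)⁻¹ (W + Y) (1 + W Y)⁻¹ (1 − W)` is strictly differentiable at `Y = 0`
# with derivative `Y ↦ (1 + W) Y (1 − W)`

Topic `NumberTheory/Weil1982`; namespace `Literature.NumberTheory.Weil1982.UnitaryFinTopForm` (continues the generic Cayley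
algebra of ★ `UnitaryFinCayleyWindow` §3 ∕ ★ `CayleyProductSandwich`: there `c(W)·c(X) = c(S(W, X))` for the Cayley map
`c(X) = (1 + X)(1 − X)⁻¹`, as a RING identity).  THEOREMS ONLY (no definition ∕ instance ∕ notation ∕ named fact ∕ `sorry`);
Mathlib-only imports.  Cell `pub/hodgecm-mathlib`, crux H413 = `stmt-HodgeConjecture-24833` (lane `--supports`, count-neutral):
ROAD «HC-D» (F0P2-p01 (g23), in-house pay-down of the local integrability `|D_G|^{−1∕2} ∈ L¹_loc` [HarishChandra1970 VII §1
Thm. 15]), brick (D6a) «CAYLEY CHART AT AN ARBITRARY POINT», analytic half; seat F0P3a-p06 (g21).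

THE MATHEMATICS ([Serre1992LALG] Part II Ch. IV §8–§9: the group law of a standard group in its chart is analytic with linear
part the identity; [Schikhof1984] §27 (strict ∕ `C¹` differentiability and local invertibility over non-archimedean fields)).
Over a complete non-trivially normed field `K` which is a normed `𝕜`-algebra (`𝕜 = K`, or `𝕜 ⊆ K` a closed subfield), for
square matrices `W, Y ∈ M_n(K)`:
* §1 `hasStrictFDerivAt_inv_one_add_mul` — `Y ↦ (1 + W Y)⁻¹` is strictly differentiable at `0` with derivative `Z ↦ −W Z`
  (the Banach-algebra derivative of `Ring.inverse` at `1`, Mathlib `hasStrictFDerivAt_ringInverse`, through the `L¹–L∞`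
  operator norm `Matrix.linftyOpNormedRing` introduced by `letI` INSIDE PROOFS ONLY — no instance attribute; the statements
  carry the default product topology of `Matrix n n K` (= the topology of the elementwise sup norm of ROAD «HC-D» ruling R1) and
  instance-free continuous linear maps, so consumers under `open scoped Matrix.Norms.Elementwise` use them verbatim);
* §2 **`hasStrictFDerivAt_cayleySandwich`** — for `1 − W` invertible, `Y ↦ S(W, Y)` is strictly differentiable at `0` with
  derivative **`Z ↦ (1 + W) Z (1 − W)`** (product rule; `(1 − W)⁻¹ (1 − W²) = 1 + W`), and `S(W, 0) = W`;
* §3 `exists_continuousLinearEquiv_sandwichDeriv` — for `1 ± W` invertible the derivative is a continuous linear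
  AUTOMORPHISM with inverse `Z ↦ (1 + W)⁻¹ Z (1 − W)⁻¹`; `eventually_isUnit_det_one_add_mul`, `eventually_isUnit_det_one_sub` —
  `1 + W Y` and `1 − Y` are invertible for `Y` near `0`.
Consumed by `Theorems/F0P3cStCharTSHCDCayleyChartAt` (the left translate `g₀ · c(Y) = z · c(S(X₀, Y))` of the Cayley chart is a
Newton chart at depth `k₀`, via ★ `F0P3cStCharTSStrictDerivNewton.exists_depth_chart`).
HONEST LABEL: HC_CM is proved only modulo the 7 printed citations (2 remaining: hLiu418 = `stmt-HodgeConjecture-24832`, h413 =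
`stmt-HodgeConjecture-24833`) until rung 0 closes; this file closes no organ.

## References
* [Serre1992LALG] J.-P. Serre, *Lie Algebras and Lie Groups*, LNM 1500 (1992), Part II Ch. IV §8–§9 (standard groups, analytic
  group chunks).
* [Schikhof1984] W. H. Schikhof, *Ultrametric Calculus*, Cambridge Stud. Adv. Math. 4 (1984), §27 (Lemma 27.4–Thm. 27.5).
-/

set_option autoImplicit false

open Matrix Filter Topology
open scoped RightActions

namespace Literature.NumberTheory.Weil1982.UnitaryFinTopForm

/-! ## §0 Auxiliary: geometric series in `M_n(K)` for the `L¹–L∞` operator norm (used only inside proofs, via `letI`) -/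

section Aux

variable {K : Type*} [NontriviallyNormedField K] [CompleteSpace K] {n : Type*} [Fintype n] [DecidableEq n]

/-- Geometric series converge in `M_n(K)` for the operator norm `Matrix.linftyOpNormedRing` (`M_n(K)` is complete as a
finite-dimensional space over the complete field `K`; the completeness instance is passed explicitly because the product uniformity
and the operator-norm uniformity are not unified by instance search). [cite: Serre1992LALG, Part II Ch. IV §9] -/
private theorem hasSummableGeomSeries_matrix_aux :
    @HasSummableGeomSeries (Matrix n n K) Matrix.linftyOpNormedRing := by
  letI : NormedRing (Matrix n n K) := Matrix.linftyOpNormedRing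
  letI : NormedAlgebra K (Matrix n n K) := Matrix.linftyOpNormedAlgebra
  have hc : CompleteSpace (Matrix n n K) := FiniteDimensional.complete K (Matrix n n K)
  constructor
  intro ξ hξ
  have h1 : Summable fun k : ℕ => ‖ξ‖ ^ k := summable_geometric_of_lt_one (norm_nonneg _) hξ
  exact @Summable.of_norm_bounded_eventually_nat _ _ hc _ _ h1 (eventually_norm_pow_le ξ)

end Aux

/-! ## §1–§3 Exported statements (default topology of `Matrix n n K`; instance-free continuous linear maps) -/

section Main

variable {𝕜 : Type*} [NontriviallyNormedField 𝕜] {K : Type*} [NontriviallyNormedField K] [NormedAlgebra 𝕜 K] [CompleteSpace K]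
  {n : Type*} [Fintype n] [DecidableEq n]

omit [CompleteSpace K] in
/-- `1 + W Y` is invertible for `Y` near `0` (continuity of the determinant, `det 1 = 1`). [cite: Serre1992LALG, Part II Ch. IV §8] -/
theorem eventually_isUnit_det_one_add_mul (W : Matrix n n K) :
    ∀ᶠ Y in 𝓝 (0 : Matrix n n K), IsUnit (1 + W * Y).det := by
  have hc : Continuous fun Y : Matrix n n K => (1 + W * Y).det :=
    (continuous_const.add (continuous_const.mul continuous_id)).matrix_det
  have h1 : (1 + W * 0 : Matrix n n K).det ≠ 0 := by simp
  have hopen : IsOpen {Y : Matrix n n K | (1 + W * Y).det ≠ 0} := isOpen_ne_fun hc continuous_const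
  filter_upwards [hopen.mem_nhds h1] with Y hY
  exact isUnit_iff_ne_zero.2 hY

omit [CompleteSpace K] in
/-- `1 − Y` is invertible for `Y` near `0`. [cite: Serre1992LALG, Part II Ch. IV §8] -/
theorem eventually_isUnit_det_one_sub :
    ∀ᶠ Y in 𝓝 (0 : Matrix n n K), IsUnit (1 - Y).det := by
  have hc : Continuous fun Y : Matrix n n K => (1 - Y).det := (continuous_const.sub continuous_id).matrix_det
  have h1 : (1 - 0 : Matrix n n K).det ≠ 0 := by simp
  have hopen : IsOpen {Y : Matrix n n K | (1 - Y).det ≠ 0} := isOpen_ne_fun hc continuous_const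
  filter_upwards [hopen.mem_nhds h1] with Y hY
  exact isUnit_iff_ne_zero.2 hY

omit [CompleteSpace K] in
/-- The value of the sandwich at `Y = 0` is `W` (for `1 − W` invertible). [cite: Serre1992LALG, Part II Ch. IV §8] -/
theorem cayleySandwich_at_zero {W : Matrix n n K} (hW : IsUnit (1 - W).det) :
    (1 - W)⁻¹ * (W + 0) * (1 + W * 0)⁻¹ * (1 - W) = W := by
  have h1 : (1 - W)⁻¹ * (1 - W) = 1 := Matrix.nonsing_inv_mul _ hW
  have hcomm : W * (1 - W) = (1 - W) * W := by noncomm_ring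
  rw [add_zero, mul_zero, add_zero, inv_one, mul_one, mul_assoc, hcomm, ← mul_assoc, h1, one_mul]

/-- **Strict derivative of `Y ↦ (1 + W Y)⁻¹` at `0`: `Z ↦ −(W Z)`.** [cite: Schikhof1984, §27 Thm. 27.5] -/
theorem hasStrictFDerivAt_inv_one_add_mul (W : Matrix n n K) :
    HasStrictFDerivAt (fun Y : Matrix n n K => (1 + W * Y)⁻¹)
      ⟨-(LinearMap.mulLeft 𝕜 W), (continuous_const.mul continuous_id).neg⟩ 0 := by
  letI : NormedRing (Matrix n n K) := Matrix.linftyOpNormedRing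
  letI : NormedAlgebra 𝕜 (Matrix n n K) := Matrix.linftyOpNormedAlgebra
  haveI := hasSummableGeomSeries_matrix_aux (K := K) (n := n)
  -- `Y ↦ 1 + W Y` and `Ring.inverse` at `1`
  have hlin : HasStrictFDerivAt (fun Y : Matrix n n K => 1 + W * Y) (W • ContinuousLinearMap.id 𝕜 (Matrix n n K)) 0 :=
    ((hasStrictFDerivAt_id (𝕜 := 𝕜) (0 : Matrix n n K)).const_mul W).const_add 1
  have h0 : (1 + W * 0 : Matrix n n K) = ((1 : (Matrix n n K)ˣ) : Matrix n n K) := by rw [mul_zero, add_zero, Units.val_one]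
  have hinv := hasStrictFDerivAt_ringInverse (𝕜 := 𝕜) (R := Matrix n n K) (1 : (Matrix n n K)ˣ)
  rw [← h0] at hinv
  have hfun : (fun Y : Matrix n n K => (1 + W * Y)⁻¹) = fun Y : Matrix n n K => Ring.inverse (1 + W * Y) := by
    funext Y
    exact Matrix.nonsing_inv_eq_ringInverse _
  rw [hfun]
  refine (hinv.comp (0 : Matrix n n K) hlin).congr_fderiv (ContinuousLinearMap.ext fun Z => ?_)
  simp only [ContinuousLinearMap.comp_apply, _root_.neg_apply, ContinuousLinearMap.mulLeftRight_apply, inv_one,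
    Units.val_one, one_mul, mul_one]
  rfl

/-- **Strict derivative of the Cayley sandwich at `0`**: for `1 − W` invertible,
`Y ↦ S(W, Y) = (1 − W)⁻¹ (W + Y) (1 + W Y)⁻¹ (1 − W)` has strict derivative **`Z ↦ (1 + W) Z (1 − W)`** at `Y = 0` — the linear part of
left multiplication by `c(W)` read in the Cayley chart. [cite: Serre1992LALG, Part II Ch. IV §8] [cite: Schikhof1984, §27 Thm. 27.5] -/
theorem hasStrictFDerivAt_cayleySandwich {W : Matrix n n K} (hW : IsUnit (1 - W).det) :
    HasStrictFDerivAt (fun Y : Matrix n n K => (1 - W)⁻¹ * (W + Y) * (1 + W * Y)⁻¹ * (1 - W))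
      ⟨(LinearMap.mulLeft 𝕜 (1 + W)).comp (LinearMap.mulRight 𝕜 (1 - W)),
        (continuous_const.mul (continuous_id.mul continuous_const))⟩ 0 := by
  letI : NormedRing (Matrix n n K) := Matrix.linftyOpNormedRing
  letI : NormedAlgebra 𝕜 (Matrix n n K) := Matrix.linftyOpNormedAlgebra
  -- the two factors `a(Y) = (1 − W)⁻¹ (W + Y)` and `b(Y) = (1 + W Y)⁻¹ (1 − W)`
  have ha : HasStrictFDerivAt (fun Y : Matrix n n K => (1 - W)⁻¹ * (W + Y))
      ((1 - W)⁻¹ • ContinuousLinearMap.id 𝕜 (Matrix n n K)) 0 :=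
    ((hasStrictFDerivAt_id (𝕜 := 𝕜) (0 : Matrix n n K)).const_add W).const_mul (1 - W)⁻¹
  have hb : HasStrictFDerivAt (fun Y : Matrix n n K => (1 + W * Y)⁻¹ * (1 - W))
      ((⟨-(LinearMap.mulLeft 𝕜 W), (continuous_const.mul continuous_id).neg⟩ : Matrix n n K →L[𝕜] Matrix n n K) <• (1 - W)) 0 :=
    (hasStrictFDerivAt_inv_one_add_mul (𝕜 := 𝕜) W).mul_const' (1 - W)
  have hab := ha.mul' hb
  have hfun : (fun Y : Matrix n n K => (1 - W)⁻¹ * (W + Y) * (1 + W * Y)⁻¹ * (1 - W)) =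
      (fun Y : Matrix n n K => (1 - W)⁻¹ * (W + Y)) * fun Y : Matrix n n K => (1 + W * Y)⁻¹ * (1 - W) := by
    funext Y
    simp only [Pi.mul_apply, mul_assoc]
  rw [hfun]
  refine hab.congr_fderiv (ContinuousLinearMap.ext fun Z => ?_)
  have h1 : (1 - W)⁻¹ * (1 - W) = 1 := Matrix.nonsing_inv_mul _ hW
  simp only [_root_.add_apply, _root_.smul_apply, smul_eq_mul, op_smul_eq_mul, add_zero, mul_zero, inv_one, one_mul]
  -- `(1−W)⁻¹ W · (−(W Z)(1−W)) + (1−W)⁻¹ Z · (1−W) = (1+W) Z (1−W)`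
  calc (1 - W)⁻¹ * W * (-(W * Z) * (1 - W)) + (1 - W)⁻¹ * Z * (1 - W)
      = (1 - W)⁻¹ * ((1 - W) * ((1 + W) * Z)) * (1 - W) := by noncomm_ring
    _ = (1 - W)⁻¹ * (1 - W) * ((1 + W) * Z) * (1 - W) := by simp only [mul_assoc]
    _ = (1 + W) * (Z * (1 - W)) := by rw [h1, one_mul, mul_assoc]

omit [CompleteSpace K] in
/-- **The derivative is an automorphism**: for `1 ± W` invertible, `Z ↦ (1 + W) Z (1 − W)` is a continuous linear automorphism of `M_n(K)`
(over any `𝕜` for which `K` is a normed `𝕜`-algebra) with inverse `Z ↦ (1 + W)⁻¹ Z (1 − W)⁻¹`. [cite: Serre1992LALG, Part II Ch. IV §8] -/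
theorem exists_continuousLinearEquiv_sandwichDeriv {W : Matrix n n K} (hm : IsUnit (1 - W).det) (hp : IsUnit (1 + W).det) :
    ∃ e : Matrix n n K ≃L[𝕜] Matrix n n K,
      (∀ Z, e Z = (1 + W) * Z * (1 - W)) ∧ (∀ Z, e.symm Z = (1 + W)⁻¹ * Z * (1 - W)⁻¹) ∧
      (e : Matrix n n K →L[𝕜] Matrix n n K) =
        ⟨(LinearMap.mulLeft 𝕜 (1 + W)).comp (LinearMap.mulRight 𝕜 (1 - W)),
          (continuous_const.mul (continuous_id.mul continuous_const))⟩ := by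
  have hp1 : (1 + W)⁻¹ * (1 + W) = 1 := Matrix.nonsing_inv_mul _ hp
  have hp2 : (1 + W) * (1 + W)⁻¹ = 1 := Matrix.mul_nonsing_inv _ hp
  have hm1 : (1 - W)⁻¹ * (1 - W) = 1 := Matrix.nonsing_inv_mul _ hm
  have hm2 : (1 - W) * (1 - W)⁻¹ = 1 := Matrix.mul_nonsing_inv _ hm
  let f : Matrix n n K →L[𝕜] Matrix n n K :=
    ⟨(LinearMap.mulLeft 𝕜 (1 + W)).comp (LinearMap.mulRight 𝕜 (1 - W)), (continuous_const.mul (continuous_id.mul continuous_const))⟩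
  let g : Matrix n n K →L[𝕜] Matrix n n K :=
    ⟨(LinearMap.mulLeft 𝕜 (1 + W)⁻¹).comp (LinearMap.mulRight 𝕜 (1 - W)⁻¹),
      (continuous_const.mul (continuous_id.mul continuous_const))⟩
  have hf : ∀ Z, f Z = (1 + W) * (Z * (1 - W)) := fun Z => rfl
  have hg : ∀ Z, g Z = (1 + W)⁻¹ * (Z * (1 - W)⁻¹) := fun Z => rfl
  have hgf : ∀ Z, g (f Z) = Z := fun Z => by
    rw [hf, hg]
    calc (1 + W)⁻¹ * ((1 + W) * (Z * (1 - W)) * (1 - W)⁻¹) = ((1 + W)⁻¹ * (1 + W)) * Z * ((1 - W) * (1 - W)⁻¹) := by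
          noncomm_ring
      _ = Z := by rw [hp1, hm2, one_mul, mul_one]
  have hfg : ∀ Z, f (g Z) = Z := fun Z => by
    rw [hf, hg]
    calc (1 + W) * ((1 + W)⁻¹ * (Z * (1 - W)⁻¹) * (1 - W)) = ((1 + W) * (1 + W)⁻¹) * Z * ((1 - W)⁻¹ * (1 - W)) := by
          noncomm_ring
      _ = Z := by rw [hp2, hm1, one_mul, mul_one]
  refine ⟨ContinuousLinearEquiv.equivOfInverse f g hgf hfg, fun Z => ?_, fun Z => ?_, rfl⟩
  · show f Z = _
    rw [hf, mul_assoc]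
  · show g Z = _
    rw [hg, mul_assoc]

end Main

end Literature.NumberTheory.Weil1982.UnitaryFinTopForm
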